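import Mathlib
import Literature.NumberTheory.GaloisRepresentations.Pseudocharacter
import HarnessLib

/-!
# The Cayley–Hamilton identity of a linear pseudocharacter (bounded algebraicity)

Topic `NumberTheory/GaloisRepresentations`; part 4 of the proof of Taylor's theorem
(`Hida2000_thm_2_18_1`): the **Cayley–Hamilton identity** of a linear pseudocharacter.

* `frobeniusS_cons_succ` — Rouquier's recursion for a tuple `(b, f_0, …, f_n)` with the
  distinguished entry in the FIRST slot (the recursion expands in the last slot, so the class of
  such tuples is stable and no symmetry of `S_n` is needed);
* `exists_polynomial_frobeniusS_cons_pow` — for `k`-linear `T`, `a ∈ R` and exponents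
  `m_j ≥ 1` with `∑ m_j = M`: `S_{n+1}(T)(b, a^{m_0}, …, a^{m_{n-1}}) = T(b · P(a))` for a polynomial
  `P` of degree `≤ M` with top coefficient `(-1)^n n!`, uniformly in `b`;
* `IsPseudocharacter.exists_polynomial_cayleyHamilton`, `…'`, `exists_monic_cayleyHamilton` — for a
  linear pseudocharacter of dimension `d`: **`T(b · P_a(a)) = 0 = T(P_a(a) · b)` for all `b`**,
  with `P_a` of degree `≤ d` and top coefficient `(-1)^d d!`, monic of degree `d` over a field of
  characteristic `0`. In the non-degenerate quotient this says every element is algebraic of degree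
  `≤ d` — the form of the Cayley–Hamilton theorem for pseudocharacters used by Taylor and Rouquier
  [cite: Taylor1991, §1], [cite: Rouquier1996, §2], [cite: BellaicheChenevier2009, §1.2].

## References

* R. Taylor, Duke Math. J. 63 (1991), §1 [Taylor1991].
* R. Rouquier, J. Algebra 180 (1996), §2 [Rouquier1996].
* J. Bellaïche, G. Chenevier, Astérisque 324 (2009), §1.2 [BellaicheChenevier2009].
-/

namespace Literature.NumberTheory.GaloisRepresentations

open Function Finset Polynomial

universe u v

/-! ### Expanding `S_{n+2}(b, f_0, …, f_n)` in the last slot -/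

section Monoid

variable {G : Type u} [Monoid G] {A : Type v} [CommRing A]

/-- `init (cons b f) = cons b (init f)`. [folklore] -/
lemma init_cons_eq {α : Type*} {n : ℕ} (b : α) (f : Fin (n + 1) → α) :
    Fin.init (Fin.cons b f : Fin (n + 2) → α) = Fin.cons b (Fin.init f) := by
  funext i
  refine Fin.cases ?_ (fun j => ?_) i
  · simp [Fin.init]
  · simp only [Fin.init, Fin.cons_succ]
    rw [← Fin.succ_castSucc, Fin.cons_succ]

/-- Rouquier's recursion for a tuple `(b, f_0, …, f_n)` whose distinguished entry `b` sits in
the first slot: the merged slots are `b f_n` (first slot) and `f_j f_n`. [folklore] -/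
theorem frobeniusS_cons_succ (T : G → A) (n : ℕ) (b : G) (f : Fin (n + 1) → G) :
    frobeniusS T (n + 2) (Fin.cons b f) =
      T (f (Fin.last n)) * frobeniusS T (n + 1) (Fin.cons b (Fin.init f)) -
        (frobeniusS T (n + 1) (Fin.cons (b * f (Fin.last n)) (Fin.init f)) +
          ∑ j : Fin n, frobeniusS T (n + 1)
            (Fin.cons b (update (Fin.init f) j (f (Fin.castSucc j) * f (Fin.last n))))) := by
  rw [frobeniusS_succ, init_cons_eq, Fin.sum_univ_succ]
  have hlast : (Fin.cons b f : Fin (n + 2) → G) (Fin.last (n + 1)) = f (Fin.last n) := by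
    rw [← Fin.succ_last, Fin.cons_succ]
  simp only [hlast, Fin.castSucc_zero, Fin.cons_zero, Fin.update_cons_zero]
  congr 2
  refine sum_congr rfl fun j _ => ?_
  rw [← Fin.succ_castSucc, Fin.cons_succ, ← Fin.cons_update]

end Monoid

/-! ### The Cayley–Hamilton polynomial of an element -/

section CayleyHamilton

variable {k : Type u} [CommRing k] {R : Type v} [Ring R] [Algebra k R]

/-- **Cayley–Hamilton expansion.** Let `T : R → k` be `k`-linear, `a ∈ R`, and
`m_0, …, m_{n-1} ≥ 1` with `∑ m_j = M` (`T` linear; centrality is not needed). There is a polynomial `P ∈ k[X]` of degree `≤ M` with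
top coefficient `P_M = (-1)^n n!` such that for every `b ∈ R`,
`S_{n+1}(T)(b, a^{m_0}, …, a^{m_{n-1}}) = T(b · P(a))`.
(Induction on `n` with Rouquier's recursion in the last slot, `frobeniusS_cons_succ`: the first
slot stays the distinguished one, so no symmetry of `S_n` is needed.)
[cite: Rouquier1996, §2], [cite: Taylor1991, §1] -/
theorem exists_polynomial_frobeniusS_cons_pow (T : R →ₗ[k] k)
    (a : R) : ∀ (n : ℕ) (m : Fin n → ℕ) (M : ℕ), (∀ j, 1 ≤ m j) → ∑ j, m j = M →
      ∃ P : k[X], P.natDegree ≤ M ∧ P.coeff M = (-1) ^ n * n.factorial ∧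
        ∀ b : R, frobeniusS T (n + 1) (Fin.cons b fun j => a ^ m j) = T (b * aeval a P)
  | 0, m, M, _, hM => by
    refine ⟨1, by simp, ?_, fun b => ?_⟩
    · simp only [univ_eq_empty, sum_empty] at hM
      subst hM; simp
    · simp
  | n + 1, m, M, hm, hM => by
    -- data of the induction
    set mL := m (Fin.last n) with hmL
    set m₀ : Fin n → ℕ := Fin.init m with hm₀
    have hmL1 : 1 ≤ mL := hm _
    have hM₀ : ∑ j, m₀ j + mL = M := by rw [← hM, Fin.sum_univ_castSucc]; rfl
    obtain ⟨P₀, hP₀deg, hP₀coeff, hP₀⟩ :=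
      exists_polynomial_frobeniusS_cons_pow T a n m₀ (∑ j, m₀ j) (fun j => hm _) rfl
    -- the merged exponent vectors
    let m' : Fin n → Fin n → ℕ := fun j l => m₀ l + if l = j then mL else 0
    have hm' : ∀ j l, 1 ≤ m' j l := fun j l => le_add_right (hm _)
    have hm'sum : ∀ j, ∑ l, m' j l = M := fun j => by
      simp only [m', sum_add_distrib, sum_ite_eq', mem_univ, if_true, hM₀]
    choose P' hP'deg hP'coeff hP' using fun j =>
      exists_polynomial_frobeniusS_cons_pow T a n (m' j) M (hm' j) (hm'sum j)
    refine ⟨C (T (a ^ mL)) * P₀ - X ^ mL * P₀ - ∑ j, P' j, ?_, ?_, fun b => ?_⟩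
    · -- degree
      have h1 : (C (T (a ^ mL)) * P₀).natDegree ≤ M :=
        (natDegree_C_mul_le _ _).trans (hP₀deg.trans (by omega))
      have h2 : (X ^ mL * P₀ : k[X]).natDegree ≤ M := by
        refine (natDegree_mul_le).trans ?_
        have := natDegree_X_pow_le (R := k) mL
        omega
      have h3 : (∑ j, P' j).natDegree ≤ M :=
        natDegree_sum_le_of_forall_le _ _ fun j _ => hP'deg j
      exact (natDegree_sub_le _ _).trans (max_le ((natDegree_sub_le _ _).trans (max_le h1 h2)) h3)
    · -- top coefficient
      have h1 : (C (T (a ^ mL)) * P₀).coeff M = 0 := by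
        rw [coeff_C_mul, coeff_eq_zero_of_natDegree_lt (by omega), mul_zero]
      have h2 : (X ^ mL * P₀ : k[X]).coeff M = (-1) ^ n * n.factorial := by
        rw [← hM₀, coeff_X_pow_mul, hP₀coeff]
      rw [coeff_sub, coeff_sub, h1, h2, finsetSum_coeff, sum_congr rfl fun j _ => hP'coeff j,
        sum_const, card_univ, Fintype.card_fin, nsmul_eq_mul, Nat.factorial_succ]
      push_cast
      ring
    · -- the identity
      rw [frobeniusS_cons_succ]
      have e1 : (Fin.init fun j : Fin (n + 1) => a ^ m j) = fun j => a ^ m₀ j := rfl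
      have e3 : ∀ j : Fin n, update (fun l : Fin n => a ^ m₀ l) j
          (a ^ m (Fin.castSucc j) * a ^ mL) = fun l => a ^ m' j l := by
        intro j; funext l
        by_cases h : l = j
        · subst h; simp [m', pow_add, m₀, Fin.init]
        · simp [m', h]
      have key : T (b * aeval a (C (T (a ^ mL)) * P₀ - X ^ mL * P₀ - ∑ j, P' j)) =
          T (a ^ mL) * T (b * aeval a P₀) -
            (T (b * a ^ mL * aeval a P₀) + ∑ j, T (b * aeval a (P' j))) := by
        simp only [map_sub, map_mul, map_sum, aeval_C, aeval_X_pow, ← Algebra.smul_def, mul_sub,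
          Finset.mul_sum, mul_smul_comm, LinearMap.map_smul, smul_eq_mul, mul_assoc]
        ring
      rw [key, ← hmL, e1, hP₀, hP₀]
      simp only [e3, hP']

/-- **The Cayley–Hamilton identity of a linear pseudocharacter.** If `T : R → k` is `k`-linear
and a pseudocharacter of dimension `d` of the multiplicative monoid of `R`, then every `a ∈ R` has
a "characteristic polynomial" `P_a ∈ k[X]` of degree `≤ d` with top coefficient `(-1)^d d!` such
that `T(b · P_a(a)) = 0` for all `b` (i.e. `P_a(a) ∈ ker T`): the case `m = (1, …, 1)` of
`exists_polynomial_frobeniusS_cons_pow` combined with `S_{d+1}(T) ≡ 0`.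
[cite: Taylor1991, §1 Theorem 1 (proof)], [cite: Rouquier1996, §2] -/
theorem IsPseudocharacter.exists_polynomial_cayleyHamilton {T : R →ₗ[k] k} {d : ℕ}
    (hT : IsPseudocharacter T d) (a : R) :
    ∃ P : k[X], P.natDegree ≤ d ∧ P.coeff d = (-1) ^ d * d.factorial ∧
      ∀ b : R, T (b * aeval a P) = 0 := by
  obtain ⟨P, hdeg, hcoeff, hP⟩ :=
    exists_polynomial_frobeniusS_cons_pow T a d (fun _ => 1) d (fun _ => le_rfl) (by simp)
  refine ⟨P, hdeg, hcoeff, fun b => ?_⟩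
  rw [← hP b]
  exact hT.frobenius _

/-- The Cayley–Hamilton identity, two-sided form (`T` central): `T(P_a(a) · b) = 0` as well.
[cite: Taylor1991, §1 Theorem 1 (proof)] -/
theorem IsPseudocharacter.exists_polynomial_cayleyHamilton' {T : R →ₗ[k] k} {d : ℕ}
    (hT : IsPseudocharacter T d) (a : R) :
    ∃ P : k[X], P.natDegree ≤ d ∧ P.coeff d = (-1) ^ d * d.factorial ∧
      (∀ b : R, T (b * aeval a P) = 0) ∧ ∀ b : R, T (aeval a P * b) = 0 := by
  obtain ⟨P, hdeg, hcoeff, hP⟩ := hT.exists_polynomial_cayleyHamilton a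
  exact ⟨P, hdeg, hcoeff, hP, fun b => by rw [hT.map_mul_comm, hP]⟩

end CayleyHamilton

section Field

variable {k : Type u} [Field k] [CharZero k] {R : Type v} [Ring R] [Algebra k R]

/-- Over a field of characteristic `0` the Cayley–Hamilton polynomial can be taken **monic of
degree exactly `d`**. [cite: Taylor1991, §1 Theorem 1 (proof)] -/
theorem IsPseudocharacter.exists_monic_cayleyHamilton {T : R →ₗ[k] k} {d : ℕ}
    (hT : IsPseudocharacter T d) (a : R) :
    ∃ P : k[X], P.Monic ∧ P.natDegree = d ∧
      (∀ b : R, T (b * aeval a P) = 0) ∧ ∀ b : R, T (aeval a P * b) = 0 := by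
  obtain ⟨P, hdeg, hcoeff, hP, hP'⟩ := hT.exists_polynomial_cayleyHamilton' a
  have hc : P.coeff d ≠ 0 := by
    rw [hcoeff]
    exact mul_ne_zero (pow_ne_zero _ (neg_ne_zero.2 one_ne_zero))
      (Nat.cast_ne_zero.2 (Nat.factorial_ne_zero d))
  have hnat : P.natDegree = d :=
    le_antisymm hdeg (le_natDegree_of_ne_zero hc)
  have hlead : P.leadingCoeff = P.coeff d := by rw [leadingCoeff, hnat]
  have hP0 : P ≠ 0 := fun h => hc (by simp [h])
  refine ⟨C (P.coeff d)⁻¹ * P, ?_, ?_, fun b => ?_, fun b => ?_⟩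
  · rw [Monic, leadingCoeff_mul, leadingCoeff_C, hlead, inv_mul_cancel₀ hc]
  · rw [natDegree_C_mul (inv_ne_zero hc), hnat]
  · rw [aeval_mul, aeval_C, ← Algebra.smul_def, mul_smul_comm, map_smul, hP, smul_zero]
  · rw [aeval_mul, aeval_C, ← Algebra.smul_def, smul_mul_assoc, map_smul, hP', smul_zero]

end Field

end Literature.NumberTheory.GaloisRepresentations
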